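import Summits.Ventures.LatticeQCDFlow.Scoring.U1SectorWeightFourier
import Literature.Analysis.FunctionSpaces.BesselIGeneratingFunction
import HarnessLib

/-!
# The Fourier transform of the one-plaquette weight at the lattice points: `𝓕 p_β (n/2π) = 2π e^{−β} I_{|n|}(β)`

HONEST FRAMING: exact (Metropolis-corrected) sampling algorithms for lattice gauge theory;
figures of merit are autocorrelation/cost numbers at stated couplings and volumes; no
continuum-physics claim.

Venture `LatticeQCDFlow` (cell pub-lqcd), sub-topic `Scoring`; FANOUT row 5 (`s0-sun-a`), GEN-8.
NEW WORK of the cell (placement rule); preparation for the Poisson-summation identity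
`Σ_k g_V(2πk) = (2π)^{V−1} e^{−βV} Σ_{n∈ℤ} I_{|n|}(β)^V` and the Bessel form of theory-2's partition
function (`Scoring/U1TorusPartitionFunctionBessel.lean`):

* `hasCompactSupport_cconvPow` — the convolution powers `p_β^{*(n+1)}` have compact support;
* `integral_cexp_cos_mul_cexp_neg_int` — `∫_{−π}^{π} e^{β cos v} e^{−inv} dv = 2π I_{|n|}(β)` for every
  `n ∈ ℤ` (the tree's `integral_cexp_cos_mul_cexp_neg_nat`, DLMF 10.32.3, moved to the symmetric
  period by periodicity and to negative `n` by `v ↦ −v`);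
* **`fourier_u1AngleWeightC_int_div`** — `𝓕 p_β (n/(2π)) = 2π e^{−β} I_{|n|}(β)` (complex form);
* `fourier_comp_mul_left` — the dilation rule `𝓕(g(a·))(ξ) = |a|⁻¹ 𝓕 g(ξ/a)`, `a ≠ 0`.

Elementary on top of Mathlib and the tree's Bessel files; nothing new is cited.
-/

noncomputable section

open MeasureTheory Set Real Filter Topology Complex
open scoped ENNReal Convolution FourierTransform
open Literature.Analysis.FunctionSpaces

namespace Summit.Ventures.LatticeQCDFlow.Scoring

variable (β : ℝ)

/-- The convolution powers of the compactly supported weight have compact support. -/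
theorem hasCompactSupport_cconvPow (n : ℕ) : HasCompactSupport (cconvPow β n) := by
  induction n with
  | zero => exact hasCompactSupport_u1AngleWeightC β
  | succ n ih =>
    rw [cconvPow_succ]
    exact (hasCompactSupport_u1AngleWeightC β).convolution (L := ContinuousLinearMap.mul ℂ ℂ) ih

/-- The integrand `e^{β cos v} e^{−imv}` (`m ∈ ℕ`) is `2π`-periodic. -/
theorem periodic_cexp_cos_mul_cexp_neg (m : ℕ) :
    Function.Periodic (fun v : ℝ => cexp ((β : ℂ) * Real.cos v) * cexp (-((m : ℂ) * v * I)))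
      (2 * π) := by
  intro v
  simp only
  rw [Real.cos_add_two_pi]
  congr 1
  rw [show -((m : ℂ) * ((v + 2 * π : ℝ) : ℂ) * I) = -((m : ℂ) * v * I) + -((m : ℂ) * (2 * π * I)) by
    push_cast; ring, Complex.exp_add, Complex.exp_neg ((m : ℂ) * (2 * π * I)),
    Complex.exp_nat_mul_two_pi_mul_I, inv_one, mul_one]

/-- `∫_{−π}^{π} e^{β cos v} e^{−imv} dv = 2π I_m(β)` for `m ∈ ℕ` (DLMF 10.32.3 on the symmetric period). -/
theorem integral_cexp_cos_mul_cexp_neg_nat_symm (m : ℕ) :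
    ∫ v in (-π)..π, cexp ((β : ℂ) * Real.cos v) * cexp (-((m : ℂ) * v * I)) =
      2 * π * (besselI m β : ℂ) := by
  have h := (periodic_cexp_cos_mul_cexp_neg β m).intervalIntegral_add_eq (-π) 0
  rw [show -π + 2 * π = π by ring, zero_add] at h
  rw [h]
  exact integral_cexp_cos_mul_cexp_neg_nat m β

/-- **`∫_{−π}^{π} e^{β cos v} e^{−inv} dv = 2π I_{|n|}(β)` for every `n ∈ ℤ`.** -/
theorem integral_cexp_cos_mul_cexp_neg_int (n : ℤ) :
    ∫ v in (-π)..π, cexp ((β : ℂ) * Real.cos v) * cexp (-((n : ℂ) * v * I)) =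
      2 * π * (besselI n.natAbs β : ℂ) := by
  obtain ⟨m, rfl | rfl⟩ := Int.eq_nat_or_neg n
  · rw [Int.natAbs_natCast, Int.cast_natCast]
    exact integral_cexp_cos_mul_cexp_neg_nat_symm β m
  · -- `n = -m`: substitute `v ↦ -v`
    rw [Int.natAbs_neg, Int.natAbs_natCast, Int.cast_neg, Int.cast_natCast]
    have hsub := intervalIntegral.integral_comp_neg (a := -π) (b := π)
      (f := fun v : ℝ => cexp ((β : ℂ) * Real.cos v) * cexp (-((m : ℂ) * v * I)))
    rw [neg_neg] at hsub
    calc ∫ v in (-π)..π, cexp ((β : ℂ) * Real.cos v) * cexp (-(-(m : ℂ) * v * I))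
        = ∫ v in (-π)..π, cexp ((β : ℂ) * Real.cos (-v)) *
            cexp (-((m : ℂ) * ((-v : ℝ) : ℂ) * I)) := by
          refine intervalIntegral.integral_congr fun v _ => ?_
          simp only [Real.cos_neg]
          congr 2
          push_cast
          ring
      _ = ∫ v in (-π)..π, cexp ((β : ℂ) * Real.cos v) * cexp (-((m : ℂ) * v * I)) := hsub
      _ = 2 * π * (besselI m β : ℂ) := integral_cexp_cos_mul_cexp_neg_nat_symm β m

/-- The complex one-plaquette density as an exponential: `(q_β(v) : ℂ) = e^{−β} · e^{β cos v}`. -/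
theorem coe_u1PlaqDensity_eq (v : ℝ) :
    (u1PlaqDensity β v : ℂ) = (Real.exp (-β) : ℂ) * cexp ((β : ℂ) * Real.cos v) := by
  rw [u1PlaqDensity, Complex.ofReal_exp, Complex.ofReal_exp, ← Complex.exp_add]
  congr 1
  push_cast
  ring

/-- **The Fourier transform of the one-plaquette weight at the lattice points**:
`𝓕 p_β (n/(2π)) = 2π e^{−β} I_{|n|}(β)`, `n ∈ ℤ`. -/
theorem fourier_u1AngleWeightC_int_div (n : ℤ) :
    𝓕 (u1AngleWeightC β) ((n : ℝ) / (2 * π)) =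
      ((2 * π * Real.exp (-β) * besselI n.natAbs β : ℝ) : ℂ) := by
  rw [fourier_u1AngleWeightC_eq]
  have hπ : (π : ℝ) ≠ 0 := Real.pi_pos.ne'
  have hint : ∀ v : ℝ, cexp (↑(-2 * π * v * ((n : ℝ) / (2 * π))) * I) * (u1PlaqDensity β v : ℂ) =
      (Real.exp (-β) : ℂ) * (cexp ((β : ℂ) * Real.cos v) * cexp (-((n : ℂ) * v * I))) := by
    intro v
    rw [coe_u1PlaqDensity_eq]
    have h1 : (-2 * π * v * ((n : ℝ) / (2 * π)) : ℝ) = -((n : ℝ) * v) := by field_simp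
    rw [h1]
    push_cast
    ring
  simp_rw [hint]
  rw [intervalIntegral.integral_const_mul, integral_cexp_cos_mul_cexp_neg_int]
  push_cast
  ring

/-- **Dilation rule**: `𝓕 (x ↦ g(a x)) ξ = |a|⁻¹ · 𝓕 g (ξ/a)` for `a ≠ 0`. -/
theorem fourier_comp_mul_left (g : ℝ → ℂ) {a : ℝ} (ha : a ≠ 0) (ξ : ℝ) :
    𝓕 (fun x => g (a * x)) ξ = ((|a|⁻¹ : ℝ) : ℂ) * 𝓕 g (ξ / a) := by
  rw [Real.fourier_real_eq_integral_exp_smul, Real.fourier_real_eq_integral_exp_smul]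
  have h := Measure.integral_comp_mul_left
    (fun y : ℝ => cexp (↑(-2 * π * (y / a) * ξ) * I) • g y) a
  have h2 : (fun x : ℝ => cexp (↑(-2 * π * (a * x / a) * ξ) * I) • g (a * x)) =
      fun x => cexp (↑(-2 * π * x * ξ) * I) • g (a * x) := by
    funext x; rw [mul_div_cancel_left₀ x ha]
  simp only [h2] at h
  rw [h, abs_inv, Complex.real_smul]
  congr 1
  refine integral_congr_ae (Eventually.of_forall fun y => ?_)
  simp only [smul_eq_mul]
  congr 2
  push_cast
  field_simp

end Summit.Ventures.LatticeQCDFlow.Scoring
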